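import Summits.CriticalPhenomena.PercolationContinuityZ3.Theorems.PercNearOneGluingNoHeavyLowerTailSunflowerBernsteinPentagonCheckB
import Summits.CriticalPhenomena.PercolationContinuityZ3.Theorems.PercNearOneGluingNoHeavyLowerTailSunflowerBernsteinPentagonCheckC
import HarnessLib

/-!
# `NoHeavyLowerTail` (crux stmt-CriticalPhenomena-4575), abstract sunflower cubic: THE PENTAGON CORE `C₅` IS SAFE FOR EVERY PRODUCT MEASURE

Support file (seat `prim-ineq-prove-1` gen 38; `--supports stmt-CriticalPhenomena-4575`).  No `sorry`, no named facts.
Memo: run/shared/lean/prim/prim-ineq-prove-1/FINDING-BERNSTEIN-prove1-g38.md §1–§2, §5.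

THE CORE.  `P₅ = x₀x₁ ∨ x₁x₂ ∨ x₂x₃ ∨ x₃x₄` on five points (generators = the edges of a path; not read-once, four minimal
transversals `{1,3}, {0,2,3}, {0,2,4}, {1,2,4}`, triangle-free intersection graph — outside every class treated so far:
read-once (…CoverReadOnce), `#𝒯 ≤ 3` (…CoverThree), LSM (…LSMGraded), Δ-systems (…DeltaCore)).
* **`Pentagon.safe_core : ∀ p, Safe p Pentagon.core`** — Lemma A in product form for every number of petals and EVERY product
  measure; hence (…SunflowerSafeCalculus) Lemma A / (C1-law) / the `H`, `G`, `T` rows / Kahn's Conjecture 5 on the complements hold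
  unconditionally for every sunflower of up-sets with core `P₅`.
PROOF.  The finite partition test (`safe_of_disjoint_famIn`, `disjoint_famIn_of_nonempty`, …SunflowerSafePartition) leaves the
inequalities `∏_{i<k} famIn(𝒰 i) ≤ famIn(∅)^(k−1)` for `k ≤ 5` nonempty pairwise disjoint sub-families; each is the nonnegativity on
`[0,1]^5` of a polynomial of degree `≤ k` per variable, CERTIFIED by its scaled tensor-Bernstein coefficients (…SunflowerBernsteinPoly,
…SunflowerBernsteinCertificate, …SunflowerBernsteinFamIn: `Bern.test_of_sorted`, `Bern.prod_famIn_le_of_certify`; the compiled checks `Pentagon.chk2/chk5`,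
`chk3`, `chk4` of …SunflowerBernsteinPentagonCheck / …CheckB / …CheckC); the degenerate case
`famIn(∅) = 0` is Harris (`famIn_two_le`).
-/

noncomputable section

namespace Summit.CriticalPhenomena.PercolationContinuityZ3.Theorems.SunflowerPartition

namespace SafeCalc

open MeasureTheory Finset
open Literature.Probability.LatticeModels Literature.Probability.Percolation

namespace Pentagon

/-! ## The core and its transversals -/

/-- The generators of `C₅`: the five edges of the cycle `0 – 1 – 2 – 3 – 4 – 0`. [this work] -/
def G : Fin 5 → Finset (Fin 5) := ![{0, 1}, {1, 2}, {2, 3}, {3, 4}, {0, 4}]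

/-- The pentagon core `C₅ = x₀x₁ ∨ x₁x₂ ∨ x₂x₃ ∨ x₃x₄ ∨ x₄x₀` as an event of the five-point cube. [this work] -/
def core : Set (Set (Fin 5)) := {ω | ∃ j, (↑(G j) : Set (Fin 5)) ⊆ ω}

/-- The family of minimal transversals of `C₅` (indexed by `C` of the check file). [this work] -/
def 𝒯 : Finset (Finset (Fin 5)) := univ.image C

/-- The core is determined by the (whole) block. [this work] -/
theorem determinedBy_core : DeterminedBy core (↑(univ : Finset (Fin 5)) : Set (Fin 5)) := by
  rw [determinedBy_iff]
  intro ω ω' h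
  rw [coe_univ, Set.inter_univ, Set.inter_univ] at h
  rw [h]

/-- The core is an up-set. [this work] -/
theorem isUpperSet_core : IsUpperSet core := by
  rintro ω ω' hle ⟨j, hj⟩
  exact ⟨j, hj.trans hle⟩

/-- The members of `𝒯` lie in the block. [this work] -/
theorem 𝒯_subset : ∀ D ∈ 𝒯, D ⊆ (univ : Finset (Fin 5)) := fun D _ => subset_univ D

/-- Every member of `𝒯` is bad (a transversal of the generators). [this work] -/
theorem 𝒯_bad : ∀ D ∈ 𝒯, ((univ \ D : Finset (Fin 5)) : Set (Fin 5)) ∉ core := by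
  have key : ∀ j i, ¬ G i ⊆ univ \ C j := by decide
  intro D hD
  unfold 𝒯 at hD
  rw [mem_image] at hD
  obtain ⟨j, -, rfl⟩ := hD
  rintro ⟨i, hi⟩
  exact key j i (Finset.coe_subset.1 hi)

/-- `𝒯` covers every bad missing set. [this work] -/
theorem 𝒯_cover : ∀ T, T ⊆ (univ : Finset (Fin 5)) → ((univ \ T : Finset (Fin 5)) : Set (Fin 5)) ∉ core →
    ∃ D ∈ 𝒯, D ⊆ T := by
  have key : ∀ T : Finset (Fin 5), (∀ i, ¬ G i ⊆ univ \ T) → ∃ j, C j ⊆ T := by decide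
  intro T _ hT
  have h1 : ∀ i, ¬ G i ⊆ univ \ T := fun i hi => hT ⟨i, Finset.coe_subset.2 hi⟩
  obtain ⟨j, hj⟩ := key T h1
  exact ⟨C j, mem_image_of_mem C (mem_univ j), hj⟩

/-- `μ(core) = famIn ∅`. [this work] -/
theorem real_core (p : Fin 5 → unitInterval) : (prodBernoulli p).real core = famIn p univ 𝒯 ∅ := by
  refine (famIn_empty p univ determinedBy_core 𝒯 (fun D hD T _ hDT hTA => 𝒯_bad D hD ?_) 𝒯_cover).symm
  exact isUpperSet_core (Finset.coe_subset.2 (sdiff_subset_sdiff (subset_refl _) hDT)) hTA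

/-! ## Safety for every product measure -/

/-- **The pentagon core `C₅` is SAFE for every product measure.** [this work] -/
theorem safe_core (p : Fin 5 → unitInterval) : Safe p core := by
  refine safe_of_disjoint_famIn p univ determinedBy_core isUpperSet_core 𝒯 𝒯_subset 𝒯_bad 𝒯_cover ?_
  -- the degenerate case `famIn ∅ = 0` is Harris; otherwise reduce to nonempty members with sorted codes
  by_cases hh : famIn p univ 𝒯 ∅ = 0
  · intro n 𝒰 hsub hdisj
    rcases Nat.lt_or_ge n 2 with hn | hn
    · interval_cases n
      · simp
      · rw [Fin.prod_univ_one, pow_zero]; exact famIn_le_one _ _ _ _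
    · obtain ⟨m, rfl⟩ : ∃ m, n = m + 2 := ⟨n - 2, by omega⟩
      rw [hh, zero_pow (by omega)]
      have h2 : famIn p univ 𝒯 (𝒰 0) * famIn p univ 𝒯 (𝒰 (Fin.succ 0)) ≤ famIn p univ 𝒯 ∅ :=
        famIn_two_le p univ 𝒯_subset (hdisj 0 (Fin.succ 0) (Fin.succ_ne_zero 0).symm)
      rw [hh] at h2
      have hsplit : ∏ i, famIn p univ 𝒯 (𝒰 i) =
          famIn p univ 𝒯 (𝒰 0) * famIn p univ 𝒯 (𝒰 (Fin.succ 0)) * ∏ i : Fin m, famIn p univ 𝒯 (𝒰 (i.succ.succ)) := by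
        rw [Fin.prod_univ_succ, Fin.prod_univ_succ, mul_assoc]
      rw [hsplit]
      have hrest : ∏ i : Fin m, famIn p univ 𝒯 (𝒰 (i.succ.succ)) ≤ 1 :=
        prod_le_one (fun i _ => famIn_nonneg _ _ _ _) fun i _ => famIn_le_one _ _ _ _
      calc famIn p univ 𝒯 (𝒰 0) * famIn p univ 𝒯 (𝒰 (Fin.succ 0)) * ∏ i : Fin m, famIn p univ 𝒯 (𝒰 (i.succ.succ))
          ≤ 0 * 1 := mul_le_mul h2 hrest (prod_nonneg fun i _ => famIn_nonneg _ _ _ _) le_rfl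
        _ = 0 := by ring
  have hpos : 0 < famIn p univ 𝒯 ∅ := lt_of_le_of_ne (famIn_nonneg _ _ _ _) (Ne.symm hh)
  refine disjoint_famIn_of_nonempty p univ 𝒯 hpos (Bern.test_of_sorted C p ?_)
  intro k hk u hune hud hsort
  interval_cases k
  · simp
  · rw [Fin.prod_univ_one, pow_zero]; exact famIn_le_one _ _ _ _
  · have h := Bern.prod_famIn_le_of_certify C C_injective p 1 ![u 0, u 1]
      (chk2 (u 0) (hune 0) (u 1) (hune 1) (hud 0 1 (by decide)) (hsort 0 1 (by decide)))
    rw [Fin.prod_univ_two] at h ⊢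
    simpa using h
  · have h := Bern.prod_famIn_le_of_certify C C_injective p 2 ![u 0, u 1, u 2]
      (chk3 (u 0) (hune 0) (u 1) (hune 1) (hud 0 1 (by decide)) (hsort 0 1 (by decide)) (u 2) (hune 2) (hud 0 2 (by decide)) (hud 1 2 (by decide)) (hsort 1 2 (by decide)))
    rw [Fin.prod_univ_three] at h ⊢
    simpa using h
  · have h := Bern.prod_famIn_le_of_certify C C_injective p 3 ![u 0, u 1, u 2, u 3]
      (chk4 (u 0) (hune 0) (u 1) (hune 1) (hud 0 1 (by decide)) (hsort 0 1 (by decide)) (u 2) (hune 2) (hud 0 2 (by decide)) (hud 1 2 (by decide)) (hsort 1 2 (by decide)) (u 3) (hune 3) (hud 0 3 (by decide)) (hud 1 3 (by decide)) (hud 2 3 (by decide)) (hsort 2 3 (by decide)))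
    rw [Fin.prod_univ_four] at h ⊢
    simpa using h
  · have h := Bern.prod_famIn_le_of_certify C C_injective p 4 ![u 0, u 1, u 2, u 3, u 4]
      (chk5 (u 0) (hune 0) (u 1) (hune 1) (hud 0 1 (by decide)) (hsort 0 1 (by decide)) (u 2) (hune 2) (hud 0 2 (by decide)) (hud 1 2 (by decide)) (hsort 1 2 (by decide)) (u 3) (hune 3) (hud 0 3 (by decide)) (hud 1 3 (by decide)) (hud 2 3 (by decide)) (hsort 2 3 (by decide)) (u 4) (hune 4) (hud 0 4 (by decide)) (hud 1 4 (by decide)) (hud 2 4 (by decide)) (hud 3 4 (by decide)) (hsort 3 4 (by decide)))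
    rw [Fin.prod_univ_five] at h ⊢
    simpa using h

end Pentagon

end SafeCalc

end Summit.CriticalPhenomena.PercolationContinuityZ3.Theorems.SunflowerPartition
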